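import Summits.ResolutionOfSingularities.ResolutionOfSingularities.Theorems.MarkedTransferCampaignW46MohWindowShade
import Literature.AlgebraicGeometry.Resolution.PointBlowupKangaroo
import HarnessLib

/-!
# [OURS · L1 W4.6] Rung (iii) "Moh window", surfaces — cleaning modulo `p`-th powers and the point
  blow-up as a substitution (algebraic toolkit of the termination half)

Cell `res-hironaka`, rung L, slot W4.6, seat `res-L1-s46-pv-6` (gen 3).  Gens 0/2 banked, for the classical
pair (order, shade) in the tree's transcription of [Hauser2010, §§F–G] (`PointBlowup.State/step/shade`,
`PointBlowupShade.lean`), the NO-INCREASE law, the DECREASE laws, the terminal-case theory and the negative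
boundary (`…Cycle`, `…FixedPoint`, `…NoInvariant`).  Gen 3 is the TERMINATION half for SURFACES along
walks presented in the Hauser–Wagner frame, outside the formal `p`-fold-curve case; this file is the
algebraic toolkit its run formula (`…MohWindowShadeRunFormula.lean`) is built from:

* §1 `p`-th-power-supported polynomials (every exponent divisible by `p` — what the cleaning
  `Hauser2010.deletePthPowers` removes): closed under `+`, `Σ`, `*`, constants, `P ↦ P^p` (Frobenius) and
  under EVERY substitution `aeval f`; the cleaning kills them, is additive, does not enlarge supports, and
  COMMUTES WITH A `p`-TH-POWER-SUPPORTED FACTOR: `clean(D·W) = D·clean(W)` (`deletePthPowers_mul_of_forall`).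
* §2 two letters `σ = {j, i}`: monomials and degrees, and the translated chart transform as a substitution —
  `pointTransform p j b s · y_j^p = F(y_j, (y_i + b_i)·y_j)` — so that ONE STEP of the walk reads
  `F' · y_j^p + D = F(y_j, (y_i + b_i)·y_j)` with `D` `p`-th-power-supported (`exists_step_mul_X_pow_add`).
OURS bookkeeping about the model; NOT a statement of the manuscript [claim: Hironaka2017, status:
under-review], nothing of which is used.  AI review is weaker than expert review.
-/

noncomputable section

set_option linter.dupNamespace false -- mandated namespace of this single-conjunct summit

open MvPolynomial Finset

open scoped BigOperators

namespace Summit.ResolutionOfSingularities.ResolutionOfSingularities.Theorems.CampaignW46.MohWindowShadeCleaning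

open Literature.AlgebraicGeometry.Resolution
open Literature.AlgebraicGeometry.Resolution.PointBlowup
open Literature.AlgebraicGeometry.Resolution.Hauser2010
open Literature.Barriers.ResolutionOfSingularities (ordZero_le_of_coeff_ne_zero le_ordZero_of_forall)

variable {σ : Type*} {K : Type*} [Field K] [Fintype σ] [DecidableEq σ] [DecidableEq K]
variable (p : ℕ) [hp : Fact p.Prime] [CharP K p]

/-! ## §1. `p`-th-power-supported polynomials and the cleaning -/

omit [Fintype σ] [DecidableEq σ] [DecidableEq K] hp [CharP K p] in
/-- A `p`-th power exponent plus an exponent is a `p`-th power exponent iff the latter is. [folklore] -/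
theorem isPthPowerExponent_add_iff {a d : σ →₀ ℕ} (ha : IsPthPowerExponent p a) :
    IsPthPowerExponent p (a + d) ↔ IsPthPowerExponent p d := by
  rw [isPthPowerExponent_iff] at ha
  rw [isPthPowerExponent_iff, isPthPowerExponent_iff]
  refine ⟨fun h l => ?_, fun h l => ?_⟩
  · have h1 := h l
    rw [Finsupp.add_apply] at h1
    exact (Nat.dvd_add_right (ha l)).mp h1
  · rw [Finsupp.add_apply]
    exact dvd_add (ha l) (h l)

omit [Fintype σ] [DecidableEq K] hp [CharP K p] in
/-- Sums of `p`-th-power-supported polynomials are `p`-th-power-supported. [folklore] -/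
theorem forall_support_add {P Q : MvPolynomial σ K} (hP : ∀ d ∈ P.support, IsPthPowerExponent p d)
    (hQ : ∀ d ∈ Q.support, IsPthPowerExponent p d) :
    ∀ d ∈ (P + Q).support, IsPthPowerExponent p d := by
  intro d hd
  rcases Finset.mem_union.mp (support_add hd) with h | h
  exacts [hP d h, hQ d h]

omit [Fintype σ] [DecidableEq K] hp [CharP K p] in
/-- Products of `p`-th-power-supported polynomials are `p`-th-power-supported. [folklore] -/
theorem forall_support_mul {P Q : MvPolynomial σ K} (hP : ∀ d ∈ P.support, IsPthPowerExponent p d)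
    (hQ : ∀ d ∈ Q.support, IsPthPowerExponent p d) :
    ∀ d ∈ (P * Q).support, IsPthPowerExponent p d := by
  intro d hd
  obtain ⟨a, ha, b, hb, rfl⟩ := Finset.mem_add.mp (support_mul P Q hd)
  exact (isPthPowerExponent_add_iff p (hP a ha)).mpr (hQ b hb)

omit [Fintype σ] [DecidableEq K] hp [CharP K p] in
/-- A product with a `p`-th-power-supported left factor is `p`-th-power-supported. [folklore] -/
theorem forall_support_sum {ι : Type*} (s : Finset ι) (f : ι → MvPolynomial σ K)
    (h : ∀ x ∈ s, ∀ d ∈ (f x).support, IsPthPowerExponent p d) :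
    ∀ d ∈ (∑ x ∈ s, f x).support, IsPthPowerExponent p d := by
  classical
  induction s using Finset.induction_on with
  | empty => intro d hd; simp at hd
  | insert a s has ih =>
    rw [Finset.sum_insert has]
    exact forall_support_add p (h a (Finset.mem_insert_self a s))
      (ih fun x hx => h x (Finset.mem_insert_of_mem hx))

omit [Fintype σ] [DecidableEq σ] [DecidableEq K] hp [CharP K p] in
/-- Constants are `p`-th-power-supported. [folklore] -/
theorem forall_support_C (c : K) : ∀ d ∈ (C c : MvPolynomial σ K).support, IsPthPowerExponent p d := by
  intro d hd
  rw [← monomial_zero'] at hd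
  have h0 : d = 0 := by
    have := support_monomial_subset hd
    rw [Finset.mem_singleton] at this
    exact this
  rw [h0, isPthPowerExponent_iff]
  intro l
  exact dvd_zero p

omit [Fintype σ] [DecidableEq K] in
/-- In characteristic `p`, a `p`-th power is `p`-th-power-supported (Frobenius). [folklore] -/
theorem forall_support_pow_char (P : MvPolynomial σ K) :
    ∀ d ∈ (P ^ p).support, IsPthPowerExponent p d := by
  have h := pow_char_pow_eq_sum_monomial p 1 P
  rw [pow_one] at h
  intro d hd
  rw [h] at hd
  obtain ⟨e, -, -, rfl⟩ := exists_of_mem_support_sum_monomial _ _ _ hd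
  rw [isPthPowerExponent_iff]
  intro l
  exact ⟨e l, by simp⟩

omit [Fintype σ] [DecidableEq K] in
/-- Powers with exponent divisible by `p` are `p`-th-power-supported. [folklore] -/
theorem forall_support_pow_mul (P : MvPolynomial σ K) (n : ℕ) :
    ∀ d ∈ (P ^ (p * n)).support, IsPthPowerExponent p d := by
  rw [mul_comm, pow_mul]
  exact forall_support_pow_char p (P ^ n)

omit [Fintype σ] [DecidableEq K] in
/-- **Substitution preserves `p`-th-power support**: `D(f_1, …, f_n)` is `p`-th-power-supported whenever
`D` is, for ANY substitution `f` (each monomial of `D` is a `p`-th power of a monomial). [folklore] -/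
theorem forall_support_aeval (f : σ → MvPolynomial σ K) {D : MvPolynomial σ K}
    (hD : ∀ d ∈ D.support, IsPthPowerExponent p d) :
    ∀ d ∈ (aeval f D).support, IsPthPowerExponent p d := by
  classical
  rw [D.as_sum, map_sum]
  refine forall_support_sum p _ _ fun e he => ?_
  rw [aeval_monomial, Finsupp.prod]
  refine forall_support_mul p ?_ ?_
  · rw [MvPolynomial.algebraMap_eq]
    exact forall_support_C p _
  · -- a product of `p`-th powers
    have hdiv : ∀ l, p ∣ e l := (isPthPowerExponent_iff p e).mp (hD e he)
    have : ∏ l ∈ e.support, f l ^ e l = ∏ l ∈ e.support, f l ^ (p * (e l / p)) := by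
      refine Finset.prod_congr rfl fun l _ => ?_
      rw [Nat.mul_div_cancel' (hdiv l)]
    rw [this]
    induction e.support using Finset.induction_on with
    | empty =>
      rw [Finset.prod_empty, ← C_1]
      exact forall_support_C p 1
    | insert a s has ih =>
      rw [Finset.prod_insert has]
      exact forall_support_mul p (forall_support_pow_mul p (f a) _) ih

omit [Fintype σ] [DecidableEq K] hp [CharP K p] in
/-- The cleaning kills a `p`-th-power-supported polynomial. [folklore] -/
theorem deletePthPowers_eq_zero_of_forall {D : MvPolynomial σ K}
    (hD : ∀ d ∈ D.support, IsPthPowerExponent p d) : deletePthPowers p D = 0 := by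
  ext d
  rw [coeff_deletePthPowers, coeff_zero]
  split_ifs with h
  · rfl
  · by_contra hne
    exact h (hD d (MvPolynomial.mem_support_iff.mpr hne))

omit [Fintype σ] [DecidableEq K] hp [CharP K p] in
/-- The part of `P` removed by the cleaning is `p`-th-power-supported. [folklore] -/
theorem forall_support_sub_deletePthPowers (P : MvPolynomial σ K) :
    ∀ d ∈ (P - deletePthPowers p P).support, IsPthPowerExponent p d := by
  intro d hd
  by_contra h
  rw [MvPolynomial.mem_support_iff, coeff_sub, coeff_deletePthPowers, if_neg h, sub_self] at hd
  exact hd rfl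

omit [Fintype σ] [DecidableEq K] hp [CharP K p] in
/-- Cleaning a sum with a `p`-th-power-supported summand. [folklore] -/
theorem deletePthPowers_add_of_forall (P : MvPolynomial σ K) {D : MvPolynomial σ K}
    (hD : ∀ d ∈ D.support, IsPthPowerExponent p d) :
    deletePthPowers p (P + D) = deletePthPowers p P := by
  rw [deletePthPowers_add, deletePthPowers_eq_zero_of_forall p hD, add_zero]

omit [Fintype σ] [DecidableEq K] hp [CharP K p] in
/-- **The cleaning commutes with a `p`-th-power-supported factor**: `clean(D·W) = D·clean(W)` — a monomial
`y^{a + w}` with `a` a `p`-th power exponent is a `p`-th power monomial iff `y^w` is. [folklore] -/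
theorem deletePthPowers_mul_of_forall {D : MvPolynomial σ K}
    (hD : ∀ d ∈ D.support, IsPthPowerExponent p d) (W : MvPolynomial σ K) :
    deletePthPowers p (D * W) = D * deletePthPowers p W := by
  classical
  ext d
  rw [coeff_deletePthPowers, coeff_mul, coeff_mul]
  by_cases hPd : IsPthPowerExponent p d
  · rw [if_pos hPd]
    symm
    refine Finset.sum_eq_zero fun x hx => ?_
    rw [Finset.mem_antidiagonal] at hx
    by_cases hDa : coeff x.1 D = 0
    · rw [hDa, zero_mul]
    · have ha : IsPthPowerExponent p x.1 := hD x.1 (MvPolynomial.mem_support_iff.mpr hDa)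
      have hw : IsPthPowerExponent p x.2 := by
        rw [← isPthPowerExponent_add_iff p ha, hx]; exact hPd
      rw [coeff_deletePthPowers, if_pos hw, mul_zero]
  · rw [if_neg hPd]
    refine Finset.sum_congr rfl fun x hx => ?_
    rw [Finset.mem_antidiagonal] at hx
    by_cases hDa : coeff x.1 D = 0
    · rw [hDa, zero_mul, zero_mul]
    · have ha : IsPthPowerExponent p x.1 := hD x.1 (MvPolynomial.mem_support_iff.mpr hDa)
      have hw : ¬ IsPthPowerExponent p x.2 := by
        rw [← isPthPowerExponent_add_iff p ha, hx]; exact hPd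
      rw [coeff_deletePthPowers, if_neg hw]

omit [Fintype σ] [DecidableEq K] in
/-- Cleaning commutes with multiplication by a power `y_j^{pn}`. [folklore] -/
theorem deletePthPowers_mul_X_pow (P : MvPolynomial σ K) (j : σ) (n : ℕ) :
    deletePthPowers p (P * X j ^ (p * n)) = deletePthPowers p P * X j ^ (p * n) := by
  rw [mul_comm, deletePthPowers_mul_of_forall p (forall_support_pow_mul p (X j) n), mul_comm]

omit [Fintype σ] [DecidableEq K] hp [CharP K p] in
/-- A cleaned polynomial plus a `p`-th-power-supported one cleans back to the former: the decomposition
`Q = clean + (p-th powers)` is unique. [folklore] -/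
theorem deletePthPowers_eq_of_add_eq {A D Q : MvPolynomial σ K} (hA : deletePthPowers p A = A)
    (hD : ∀ d ∈ D.support, IsPthPowerExponent p d) (h : A + D = Q) : deletePthPowers p Q = A := by
  rw [← h, deletePthPowers_add_of_forall p A hD, hA]

omit [Fintype σ] [DecidableEq K] hp [CharP K p] in
/-- Cleaning does not lower the order: every monomial of `clean(P)` is a monomial of `P`. [folklore] -/
theorem support_deletePthPowers_subset (P : MvPolynomial σ K) :
    (deletePthPowers p P).support ⊆ P.support := by
  intro d hd
  rw [MvPolynomial.mem_support_iff, coeff_deletePthPowers] at hd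
  split_ifs at hd with h
  · exact (hd rfl).elim
  · exact MvPolynomial.mem_support_iff.mpr hd


omit [Fintype σ] [DecidableEq K] hp [CharP K p] in
/-- A polynomial none of whose monomials is a `p`-th power monomial is clean. [folklore] -/
theorem deletePthPowers_eq_self_of_forall {P : MvPolynomial σ K}
    (hP : ∀ d ∈ P.support, ¬ IsPthPowerExponent p d) : deletePthPowers p P = P := by
  ext d
  rw [coeff_deletePthPowers]
  split_ifs with h
  · by_contra hne
    exact hP d (MvPolynomial.mem_support_iff.mpr (Ne.symm hne)) h
  · rfl

/-! ## §2. Two letters: monomials, degrees, and the translated chart transform as a substitution -/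

section TwoLetters

variable {j i : σ}

omit [Fintype σ] [DecidableEq σ] [DecidableEq K] hp [CharP K p] in
/-- With two letters `σ = {j, i}`, an exponent is `d_j e_j + d_i e_i`. [folklore] -/
theorem eq_single_add_single (hij : i ≠ j) (htwo : ∀ l, l = j ∨ l = i) (d : σ →₀ ℕ) :
    d = Finsupp.single j (d j) + Finsupp.single i (d i) := by
  ext l
  rcases htwo l with rfl | rfl
  · simp [hij]
  · simp [hij.symm]

omit [DecidableEq σ] [DecidableEq K] hp [CharP K p] in
/-- With two letters, `|d| = d_j + d_i`. [folklore] -/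
theorem degree_eq_add (hij : i ≠ j) (htwo : ∀ l, l = j ∨ l = i) (d : σ →₀ ℕ) :
    d.degree = d j + d i := by
  classical
  have herase : (Finset.univ : Finset σ).erase j = {i} := by
    ext l
    rw [Finset.mem_erase, Finset.mem_singleton]
    constructor
    · rintro ⟨hlj, -⟩
      rcases htwo l with h | h
      · exact absurd h hlj
      · exact h
    · intro h; rw [h]; exact ⟨hij, Finset.mem_univ i⟩
  rw [degree_eq_add_sum_erase j d, herase, Finset.sum_singleton]

omit [Fintype σ] [DecidableEq σ] [DecidableEq K] hp [CharP K p] in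
/-- With two letters, `c·y^d = c · y_j^{d_j} · y_i^{d_i}`. [folklore] -/
theorem monomial_eq_C_mul (hij : i ≠ j) (htwo : ∀ l, l = j ∨ l = i) (d : σ →₀ ℕ) (c : K) :
    monomial d c = C c * X j ^ (d j) * X i ^ (d i) := by
  conv_lhs => rw [eq_single_add_single hij htwo d]
  rw [monomial_single_add, ← C_mul_X_pow_eq_monomial]
  ring

omit [Fintype σ] [DecidableEq σ] [DecidableEq K] hp [CharP K p] in
/-- With two letters, a substitution acts on a monomial by `c·y^d ↦ c · f_j^{d_j} · f_i^{d_i}`. [folklore] -/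
theorem aeval_monomial_two (hij : i ≠ j) (htwo : ∀ l, l = j ∨ l = i) (f : σ → MvPolynomial σ K)
    (d : σ →₀ ℕ) (c : K) : aeval f (monomial d c) = C c * f j ^ (d j) * f i ^ (d i) := by
  rw [monomial_eq_C_mul hij htwo d c, map_mul, map_mul, map_pow, map_pow, aeval_X, aeval_X, aeval_C,
    MvPolynomial.algebraMap_eq]

omit [Fintype σ] [DecidableEq σ] [DecidableEq K] hp [CharP K p] in
/-- A substitution acts termwise on the monomial expansion. [folklore] -/
theorem aeval_eq_sum_support (f : σ → MvPolynomial σ K) (P : MvPolynomial σ K) :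
    aeval f P = ∑ e ∈ P.support, aeval f (monomial e (coeff e P)) := by
  rw [← map_sum]
  congr 1
  exact P.as_sum

omit [DecidableEq K] hp [CharP K p] in
/-- **[OURS · L1 W4.6] The translated chart transform is a substitution.**  For a state whose residual
polynomial has all its monomials of degree `≥ p`, at the point `b` (`b_j = 0`) of the chart `y_j`:
`pointTransform p j b s · y_j^p = F(y_j ↦ y_j, y_i ↦ (y_i + b_i)·y_j)`.  NOT a statement of the manuscript.
[folklore] -/
theorem pointTransform_mul_X_pow (hij : i ≠ j) (htwo : ∀ l, l = j ∨ l = i) (b : σ → K) (hbj : b j = 0)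
    (s : State σ K) (hdeg : ∀ d ∈ s.F.support, p ≤ d.degree) :
    pointTransform p j b s * X j ^ p =
      aeval (fun l => if l = j then X j else (X l + C (b l)) * X j) s.F := by
  rw [pointTransform_eq_sum, Finset.sum_mul, aeval_eq_sum_support]
  refine Finset.sum_congr rfl fun d hd => ?_
  have hpd : p ≤ d.degree := hdeg d hd
  rw [degree_eq_add hij htwo d] at hpd
  unfold translate
  rw [aeval_monomial_two hij htwo, aeval_monomial_two hij htwo, if_pos rfl, if_neg hij,
    chartExponent_apply, if_pos rfl, chartExponent_apply, if_neg hij, hbj, C_0, add_zero,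
    degree_eq_add hij htwo d, mul_pow]
  have h : (X j : MvPolynomial σ K) ^ (d j + d i - p) * X j ^ p = X j ^ (d j) * X j ^ (d i) := by
    rw [← pow_add, ← pow_add, Nat.sub_add_cancel hpd]
  calc C (coeff d s.F) * X j ^ (d j + d i - p) * (X i + C (b i)) ^ (d i) * X j ^ p
      = C (coeff d s.F) * (X i + C (b i)) ^ (d i) * (X j ^ (d j + d i - p) * X j ^ p) := by ring
    _ = C (coeff d s.F) * (X i + C (b i)) ^ (d i) * (X j ^ (d j) * X j ^ (d i)) := by rw [h]
    _ = C (coeff d s.F) * X j ^ d j * ((X i + C (b i)) ^ d i * X j ^ d i) := by ring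

/-- **[OURS · L1 W4.6] One step of the walk as a substitution modulo `p`-th powers.**  Under the same
hypotheses, `F' · y_j^p + D = F(y_j, (y_i + b_i)·y_j)` for the new residual polynomial `F' = (step p j b s).F`
and some `p`-th-power-supported `D` (the part removed by the cleaning, shifted).  NOT a statement of the
manuscript. [folklore] -/
theorem exists_step_mul_X_pow_add (hij : i ≠ j) (htwo : ∀ l, l = j ∨ l = i) (b : σ → K) (hbj : b j = 0)
    (s : State σ K) (hdeg : ∀ d ∈ s.F.support, p ≤ d.degree) :
    ∃ D : MvPolynomial σ K, (∀ d ∈ D.support, IsPthPowerExponent p d) ∧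
      (step p j b s).F * X j ^ p + D = aeval (fun l => if l = j then X j else (X l + C (b l)) * X j) s.F := by
  refine ⟨(pointTransform p j b s - deletePthPowers p (pointTransform p j b s)) * X j ^ p,
    forall_support_mul p (forall_support_sub_deletePthPowers p _) (forall_support_pow_char p (X j)), ?_⟩
  rw [← pointTransform_mul_X_pow p hij htwo b hbj s hdeg]
  show deletePthPowers p (pointTransform p j b s) * X j ^ p + _ = _
  ring

end TwoLetters

end Summit.ResolutionOfSingularities.ResolutionOfSingularities.Theorems.CampaignW46.MohWindowShadeCleaning
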